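import Literature.NumberTheory.Automorphic.BrandtMatrixRamified
import HarnessLib

/-!
# Brandt matrices `B(p^a)` at a ramified prime: `B(p^a) = B(p)^a`, `B(p^{2k}) = 1`
# (Vignéras, LNM 800, Ch. III §5 ex. 5.8 (c): `P(p^a) P(p^b) = P(p^{a+b})` si `p ∣ D`)

Topic `NumberTheory/Automorphic`; theorems only (no definition, no named fact, no instance).
Sequel of `BrandtMatrixRamified.lean` (`B(p)` is an involutive permutation matrix at a prime `p`
where `ℚ_p ⊗ B` is a division algebra and the `ℤ`-order `O` is maximal at `p`). Vignéras II §1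
Lemme 1.5: "tous les idéaux normaux sont de la forme `Pⁿ`" — every right ideal of the valuation
ring `O_p` is a power of the prime `P = O u`. Hence an invertible right `O`-ideal `I` has exactly
one invertible sub-ideal of index `p^{2a}` for every `a` (locally `β u^a O_(p)`), and the Brandt
matrices at the powers of `p` are the powers of the permutation matrix `B(p)`:

* `eq_pow_uniformiser_smul_localAt` — **local**: a right `O_(p)`-stable `N ⊆ O_(p)` with
  `[O_(p) : N] = p^{2a}` is `u^a O_(p)` (induction: `N ⊆ P_(p) = u O_(p)` unless `N = O_(p)`,
  and `u⁻¹ N` has index `p^{2(a-1)}`);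
* `exists_subideal_pow`, `subideal_pow_unique` — **global**: existence (`I P^a`, built as
  `M_{a+1} = M_a P`) and uniqueness of the invertible sub-ideal of `I` of index `p^{2a}`;
* `subidealCount_ramified_pow` — `B(p^a)_{[I] j} = [j = [M_a]]`;
  `BrandtData.ofOrder_T_ramified_pow_succ` — **`B(p^{a+1}) = B(p^a) B(p)`**, so
  `BrandtData.ofOrder_T_ramified_pow` — **`B(p^a) = B(p)^a`** (Vignéras III §5 ex. 5.8 (c) for
  `p ∣ D`), and with `B(p)² = 1`: **`B(p^{2k}) = 1`, `B(p^{2k+1}) = B(p)`**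
  (`BrandtData.ofOrder_T_ramified_pow_even/odd`);
* `EichlerPackage.T_pow_of_dvd` etc. — the same for Eichler packages at `p ∣ N⁻`.

## References

* M.-F. Vignéras, *Arithmétique des algèbres de quaternions*, LNM 800 (1980), Ch. II §1
  Lemme 1.5; Ch. III §5 exercice 5.8 (c), p. 87 [VignerasLNM800].
-/

noncomputable section

open scoped Pointwise

universe u

namespace Literature.NumberTheory.Automorphic

variable {B : Type u} [Ring B] [Algebra ℚ B] [IsQuaternionAlgebra ℚ B]
variable {O : Submodule ℤ B} {p : ℕ} [hp : Fact p.Prime]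
variable (hdivp : ∀ X : ScalarExtension ℚ ℚ_[p] B, X ≠ 0 → IsUnit X)
variable (hOp : ∀ x : B, x ∈ localAt p O ↔
  ¬ p ∣ (reducedNorm ℚ B x).den ∧ ¬ p ∣ (reducedTrace ℚ B x).den)
include hdivp hOp

/-! ### Local: every right ideal of `O_(p)` of `p`-power index is a power of `P_(p)` -/

/-- `[O_(p) : u O_(p)] = p²` for a uniformiser `u`. [cite: VignerasLNM800, Ch. II §1 Cor. 1.7] -/
theorem relIndex_uniformiser_smul_localAt (hO : IsZOrder O) {u : Bˣ}
    (hu : (u : B) ∈ normPrimeIdeal O p) (hup : (u : B) ∉ (p : ℤ) • O) :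
    (u • localAt p O).toAddSubgroup.relIndex (localAt p O).toAddSubgroup = p ^ 2 := by
  rw [← localAt_normPrimeIdeal_eq_units_smul hdivp hOp hO hu hup]
  exact relIndex_localAt_normPrimeIdeal hdivp hOp hO

/-- **Every right `O_(p)`-ideal of index `p^{2a}` is `u^a O_(p)`** (Vignéras II §1 Lemme 1.5:
the integral ideals of `O_p` are the `Pⁿ`): for a right `O_(p)`-stable submodule `N ⊆ O_(p)`
with `[O_(p) : N] = p^{2a}` and a uniformiser `u`, `N = u^a O_(p)`. [cite: VignerasLNM800, Ch. II §1 Lemme 1.5] -/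
theorem eq_pow_uniformiser_smul_localAt (hO : IsZOrder O) {u : Bˣ}
    (hu : (u : B) ∈ normPrimeIdeal O p) (hup : (u : B) ∉ (p : ℤ) • O) (a : ℕ) :
    ∀ (N : Submodule ℤ B), N ≤ localAt p O → (∀ m ∈ N, ∀ o ∈ localAt p O, m * o ∈ N) →
      N.toAddSubgroup.relIndex (localAt p O).toAddSubgroup = p ^ (2 * a) →
        N = (u ^ a) • localAt p O := by
  have hdiv : ∀ x : B, x ≠ 0 → IsUnit x := forall_isUnit_of_padic_division hdivp
  induction a with
  | zero =>
    intro N hNO _ hidx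
    rw [mul_zero, pow_zero, AddSubgroup.relIndex_eq_one] at hidx
    rw [pow_zero, one_smul]
    exact le_antisymm hNO hidx
  | succ a ih =>
    intro N hNO hNmul hidx
    -- `N ⊆ P_(p) = u O_(p)`: an element of `p`-unit norm would force `N = O_(p)`
    have hNP : N ≤ u • localAt p O := fun x hx => by
      rw [← localAt_normPrimeIdeal_eq_units_smul hdivp hOp hO hu hup,
        mem_localAt_normPrimeIdeal_iff hdivp hO]
      refine ⟨hNO hx, fun hnp => ?_⟩
      have hle := localAt_le_of_exists_unit hO hdiv hNO hNmul hx hnp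
      have h1 : N.toAddSubgroup.relIndex (localAt p O).toAddSubgroup = 1 :=
        AddSubgroup.relIndex_eq_one.mpr (Submodule.toAddSubgroup_mono hle)
      rw [h1] at hidx
      have : 1 < p ^ (2 * (a + 1)) := Nat.one_lt_pow (by omega) hp.out.one_lt
      omega
    -- `N' = u⁻¹ N`
    have hN'O : u⁻¹ • N ≤ localAt p O := by
      intro x hx
      rw [mem_units_smul_submodule_iff, inv_inv] at hx
      simpa using (mem_units_smul_submodule_iff.mp (hNP hx))
    have hN'mul : ∀ m ∈ u⁻¹ • N, ∀ o ∈ localAt p O, m * o ∈ u⁻¹ • N := fun m hm o ho => by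
      rw [mem_units_smul_submodule_iff, inv_inv, Units.smul_def, smul_eq_mul] at hm ⊢
      rw [← mul_assoc]
      exact hNmul _ hm o ho
    have hN'idx : (u⁻¹ • N).toAddSubgroup.relIndex (localAt p O).toAddSubgroup = p ^ (2 * a) := by
      have hmul := AddSubgroup.relIndex_mul_relIndex N.toAddSubgroup (u • localAt p O).toAddSubgroup
        (localAt p O).toAddSubgroup (Submodule.toAddSubgroup_mono hNP)
        (Submodule.toAddSubgroup_mono (units_smul_le_of_mem_localAt hO hu))
      rw [relIndex_uniformiser_smul_localAt hdivp hOp hO hu hup, hidx,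
        show p ^ (2 * (a + 1)) = p ^ (2 * a) * p ^ 2 by ring] at hmul
      have h := Nat.eq_of_mul_eq_mul_right (pow_pos hp.out.pos 2) hmul
      rw [← relIndex_units_smul u (u⁻¹ • N) (localAt p O), smul_inv_smul]
      exact h
    have h := ih _ hN'O hN'mul hN'idx
    rw [pow_succ', mul_smul, ← h, smul_inv_smul]
where
  /-- `u O_(p) ⊆ O_(p)` for `u ∈ P ⊆ O`. -/
  units_smul_le_of_mem_localAt (hO : IsZOrder O) {u : Bˣ} (hu : (u : B) ∈ normPrimeIdeal O p) :
      u • localAt p O ≤ localAt p O := by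
    intro x hx
    obtain ⟨y, hy, rfl⟩ := (Submodule.mem_smul_pointwise_iff_exists x u _).mp hx
    exact mul_mem_localAt hO.mul_mem p (le_localAt p O (normPrimeIdeal_le O p hu)) hy

/-! ### Global: the sub-ideal of index `p^{2a}` -/

/-- **Existence**: an invertible right ideal `I` has an invertible sub-ideal of index `p^{2a}`
for every `a` (`M₀ = I`, `M_{a+1} = M_a P`). [cite: VignerasLNM800, Ch. III §5 exercice 5.8 (c)] -/
theorem exists_subideal_pow (hO : IsZOrder O) {I : Submodule ℤ B} (hI : IsInvertibleRightIdeal O I)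
    (a : ℕ) : ∃ M : Submodule ℤ B, IsInvertibleRightIdeal O M ∧ M ≤ I ∧
      M.toAddSubgroup.relIndex I.toAddSubgroup = p ^ (2 * a) := by
  induction a with
  | zero => exact ⟨I, hI, le_rfl, by rw [mul_zero, pow_zero, AddSubgroup.relIndex_self]⟩
  | succ a ih =>
    obtain ⟨M, hM, hMI, hidx⟩ := ih
    refine ⟨M * normPrimeIdeal O p, isInvertibleRightIdeal_mul_normPrimeIdeal hdivp hOp hO hM,
      (mul_normPrimeIdeal_le hM).trans hMI, ?_⟩
    rw [← AddSubgroup.relIndex_mul_relIndex (M * normPrimeIdeal O p).toAddSubgroup M.toAddSubgroup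
      I.toAddSubgroup (Submodule.toAddSubgroup_mono (mul_normPrimeIdeal_le hM))
      (Submodule.toAddSubgroup_mono hMI), relIndex_mul_normPrimeIdeal hdivp hOp hO hM, hidx]
    ring

/-- **Uniqueness**: two invertible sub-ideals of `I` of the same index `p^{2a}` coincide (both
contain `p^a I`, so agree with `I` away from `p`; at `p` both are `β u^a O_(p)`). [cite: VignerasLNM800, Ch. II §1 Lemme 1.5] -/
theorem subideal_pow_unique (hO : IsZOrder O) {I : Submodule ℤ B} (hI : IsInvertibleRightIdeal O I)
    {a : ℕ} {M M' : Submodule ℤ B} (hM : IsInvertibleRightIdeal O M) (hMI : M ≤ I)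
    (hidx : M.toAddSubgroup.relIndex I.toAddSubgroup = p ^ (2 * a))
    (hM' : IsInvertibleRightIdeal O M') (hM'I : M' ≤ I)
    (hidx' : M'.toAddSubgroup.relIndex I.toAddSubgroup = p ^ (2 * a)) : M = M' := by
  have hdiv : ∀ x : B, x ≠ 0 → IsUnit x := forall_isUnit_of_padic_division hdivp
  obtain ⟨β, -, hβ⟩ := hI.exists_localAt_eq_units_smul hdiv hO p
  obtain ⟨u, hu, hup⟩ := exists_uniformiser hdivp hO
  have hβ' : localAt p O = β⁻¹ • localAt p I := by rw [hβ, inv_smul_smul]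
  -- the local form of any such sub-ideal
  have key : ∀ {L : Submodule ℤ B}, IsInvertibleRightIdeal O L → L ≤ I →
      L.toAddSubgroup.relIndex I.toAddSubgroup = p ^ (2 * a) →
        (∀ q : ℕ, q.Prime → q ≠ p → localAt q L = localAt q I) ∧
          localAt p L = (β * u ^ a) • localAt p O := by
    intro L hL hLI hLidx
    have hpow : L.toAddSubgroup.relIndex I.toAddSubgroup = (p ^ a) ^ 2 := by rw [hLidx]; ring
    have hpI : ∀ y ∈ I, ((p ^ a : ℕ) : ℤ) • y ∈ L := fun y hy =>
      hL.natCast_smul_mem_of_relIndex_eq_sq hdiv hO hI hLI hpow hy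
    refine ⟨fun q hq hqp => ?_, ?_⟩
    · exact (localAt_eq_of_smul_le hLI (pow_ne_zero a hp.out.ne_zero)
        (Nat.Coprime.pow_left a ((Nat.coprime_primes hp.out hq).mpr (Ne.symm hqp))) hpI).symm
    · have hN := eq_pow_uniformiser_smul_localAt hdivp hOp hO hu hup a (β⁻¹ • localAt p L)
        ?_ ?_ ?_
      · rw [mul_smul, ← hN, smul_inv_smul]
      · rw [hβ']
        exact units_smul_mono β⁻¹ (localAt_mono p hLI)
      · intro m hm o ho
        rw [mem_units_smul_submodule_iff, inv_inv] at hm ⊢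
        rw [Units.smul_def, smul_eq_mul, ← mul_assoc]
        exact mul_mem_localAt_of_mul_mem (fun a ha b hb => hL.mul_mem ha hb) hm ho
      · rw [hβ', relIndex_units_smul,
          relIndex_localAt I L hLI (by rw [hLidx]; exact pow_ne_zero _ hp.out.ne_zero), hLidx,
          Nat.Prime.factorization_pow hp.out, Finsupp.single_eq_same]
  obtain ⟨h1, h2⟩ := key hM hMI hidx
  obtain ⟨h1', h2'⟩ := key hM' hM'I hidx'
  refine eq_iff_forall_prime_localAt_eq.mpr fun q hq => ?_
  by_cases hqp : q = p
  · rw [hqp, h2, h2']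
  · rw [h1 q hq hqp, h1' q hq hqp]

/-! ### The Brandt matrices `B(p^a)` -/

/-- **`B(p^a)_{[I] j} = [j = [M]]`** for the invertible sub-ideal `M ⊆ I` of index `p^{2a}`. [cite: VignerasLNM800, Ch. III §5 exercice 5.8 (c)] -/
theorem subidealCount_ramified_pow_eq_one (hO : IsZOrder O) {I : Submodule ℤ B}
    (hI : IsInvertibleRightIdeal O I) {a : ℕ} {M : Submodule ℤ B} (hM : IsInvertibleRightIdeal O M)
    (hMI : M ≤ I) (hidx : M.toAddSubgroup.relIndex I.toAddSubgroup = p ^ (2 * a))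
    {j : RightIdealClass O} (hj : RightIdealClass.mk ⟨M, hM⟩ = j) :
    subidealCount O I (p ^ a) j = 1 := by
  have hsq : (p ^ a) ^ 2 = p ^ (2 * a) := by ring
  unfold subidealCount
  rw [Nat.card_eq_one_iff_unique]
  refine ⟨⟨fun x y => Subtype.ext (Subtype.ext ?_)⟩, ⟨⟨⟨M, hM⟩, hMI, by rw [hsq, hidx], hj⟩⟩⟩
  exact (subideal_pow_unique hdivp hOp hO hI x.1.2 x.2.1 (by rw [← hsq, x.2.2.1]) hM hMI hidx).trans
    (subideal_pow_unique hdivp hOp hO hI y.1.2 y.2.1 (by rw [← hsq, y.2.2.1]) hM hMI hidx).symm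

/-- `B(p^a)_{[I] j} = 0` for `j ≠ [M]`. [cite: VignerasLNM800, Ch. III §5 exercice 5.8 (c)] -/
theorem subidealCount_ramified_pow_eq_zero (hO : IsZOrder O) {I : Submodule ℤ B}
    (hI : IsInvertibleRightIdeal O I) {a : ℕ} {M : Submodule ℤ B} (hM : IsInvertibleRightIdeal O M)
    (hMI : M ≤ I) (hidx : M.toAddSubgroup.relIndex I.toAddSubgroup = p ^ (2 * a))
    {j : RightIdealClass O} (hj : RightIdealClass.mk ⟨M, hM⟩ ≠ j) :
    subidealCount O I (p ^ a) j = 0 := by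
  have hsq : (p ^ a) ^ 2 = p ^ (2 * a) := by ring
  unfold subidealCount
  rw [Nat.card_eq_zero]
  refine Or.inl ⟨fun x => hj ?_⟩
  rw [← x.2.2.2]
  congr 1
  exact Subtype.ext (subideal_pow_unique hdivp hOp hO hI hM hMI hidx x.1.2 x.2.1 (by rw [← hsq, x.2.2.1]))

open Classical in
/-- The entries of `B(p^a)`: `B(p^a)_{i j} = [j = [M]]` for the sub-ideal `M ⊆ I_i` of index
`p^{2a}`. [cite: VignerasLNM800, Ch. III §5 exercice 5.8 (c)] -/
theorem BrandtData.ofOrder_T_ramified_pow_apply (hO : IsZOrder O) {a : ℕ} (i j : RightIdealClass O)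
    {M : Submodule ℤ B} (hM : IsInvertibleRightIdeal O M) (hMI : M ≤ RightIdealClass.rep i)
    (hidx : M.toAddSubgroup.relIndex (RightIdealClass.rep i).toAddSubgroup = p ^ (2 * a)) :
    (BrandtData.ofOrder O hO).T (p ^ a) i j = if RightIdealClass.mk ⟨M, hM⟩ = j then 1 else 0 := by
  rw [BrandtData.ofOrder_T]
  split_ifs with h
  · rw [subidealCount_ramified_pow_eq_one hdivp hOp hO (RightIdealClass.isInvertibleRightIdeal_rep i)
      hM hMI hidx h, Nat.cast_one]
  · rw [subidealCount_ramified_pow_eq_zero hdivp hOp hO (RightIdealClass.isInvertibleRightIdeal_rep i)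
      hM hMI hidx h, Nat.cast_zero]

/-- **`B(p^{a+1}) = B(p^a) B(p)`** at a ramified prime (Vignéras III §5 ex. 5.8 (c):
`P(p^a) P(p^b) = P(p^{a+b})` si `p ∣ D`): the sub-ideal of index `p^{2(a+1)}` of `I` is
`M_a P` for the sub-ideal `M_a` of index `p^{2a}`. [cite: VignerasLNM800, Ch. III §5 exercice 5.8 (c)] -/
theorem BrandtData.ofOrder_T_ramified_pow_succ (hO : IsZOrder O) (a : ℕ) :
    (BrandtData.ofOrder O hO).T (p ^ (a + 1)) = (BrandtData.ofOrder O hO).T (p ^ a) *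
      (BrandtData.ofOrder O hO).T p := by
  letI : Fintype (RightIdealClass O) := (BrandtData.ofOrder O hO).instFintype
  ext i k
  rw [Matrix.mul_apply]
  -- the sub-ideal `M` of `I_i` of index `p^{2a}`, and `M P` of index `p^{2(a+1)}`
  obtain ⟨M, hM, hMI, hidx⟩ := exists_subideal_pow hdivp hOp hO
    (RightIdealClass.isInvertibleRightIdeal_rep i) a
  have hMP : IsInvertibleRightIdeal O (M * normPrimeIdeal O p) :=
    isInvertibleRightIdeal_mul_normPrimeIdeal hdivp hOp hO hM
  have hMPI : M * normPrimeIdeal O p ≤ RightIdealClass.rep i := (mul_normPrimeIdeal_le hM).trans hMI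
  have hidxP : (M * normPrimeIdeal O p).toAddSubgroup.relIndex (RightIdealClass.rep i).toAddSubgroup =
      p ^ (2 * (a + 1)) := by
    rw [← AddSubgroup.relIndex_mul_relIndex (M * normPrimeIdeal O p).toAddSubgroup M.toAddSubgroup
      (RightIdealClass.rep i).toAddSubgroup (Submodule.toAddSubgroup_mono (mul_normPrimeIdeal_le hM))
      (Submodule.toAddSubgroup_mono hMI), relIndex_mul_normPrimeIdeal hdivp hOp hO hM, hidx]
    ring
  set j₀ : RightIdealClass O := RightIdealClass.mk ⟨M, hM⟩ with hj₀
  have hsum : ∑ j, (BrandtData.ofOrder O hO).T (p ^ a) i j * (BrandtData.ofOrder O hO).T p j k =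
      (BrandtData.ofOrder O hO).T (p ^ a) i j₀ * (BrandtData.ofOrder O hO).T p j₀ k := by
    refine Fintype.sum_eq_single j₀ fun j hj => ?_
    rw [BrandtData.ofOrder_T_ramified_pow_apply hdivp hOp hO i j hM hMI hidx,
      if_neg (fun h => hj (h ▸ hj₀).symm), zero_mul]
  rw [hsum, BrandtData.ofOrder_T_ramified_pow_apply hdivp hOp hO i j₀ hM hMI hidx, if_pos hj₀.symm,
    one_mul, hj₀, BrandtData.ofOrder_T_mk, BrandtData.ofOrder_T_ramified_pow_apply hdivp hOp hO i k hMP hMPI hidxP]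
  -- `B(p)_{[M] k} = [k = [M P]]`
  split_ifs with h
  · rw [subidealCount_ramified_eq_one hdivp hOp hO hM h, Nat.cast_one]
  · rw [subidealCount_ramified_eq_zero hdivp hOp hO hM h, Nat.cast_zero]

/-- **`B(p^a) = B(p)^a`** at a ramified prime. [cite: VignerasLNM800, Ch. III §5 exercice 5.8 (c)] -/
theorem BrandtData.ofOrder_T_ramified_pow (hO : IsZOrder O) (a : ℕ) :
    (BrandtData.ofOrder O hO).T (p ^ a) = (BrandtData.ofOrder O hO).T p ^ a := by
  induction a with
  | zero => rw [pow_zero, pow_zero, BrandtData.ofOrder_T_one]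
  | succ a ih => rw [BrandtData.ofOrder_T_ramified_pow_succ hdivp hOp hO a, ih, pow_succ]

/-- **`B(p^{2k}) = 1`** at a ramified prime (`B(p)² = 1`; in particular `B(p²) = 1`, the
permutation matrix `L(p)` of the principal ideal `(p)`). [cite: VignerasLNM800, Ch. III §5 exercice 5.8 (c)] -/
theorem BrandtData.ofOrder_T_ramified_pow_even (hO : IsZOrder O) (k : ℕ) :
    (BrandtData.ofOrder O hO).T (p ^ (2 * k)) = 1 := by
  rw [BrandtData.ofOrder_T_ramified_pow hdivp hOp hO, pow_mul,
    sq, BrandtData.ofOrder_T_ramified_mul_self hdivp hOp hO, one_pow]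

/-- **`B(p^{2k+1}) = B(p)`** at a ramified prime. [cite: VignerasLNM800, Ch. III §5 exercice 5.8 (c)] -/
theorem BrandtData.ofOrder_T_ramified_pow_odd (hO : IsZOrder O) (k : ℕ) :
    (BrandtData.ofOrder O hO).T (p ^ (2 * k + 1)) = (BrandtData.ofOrder O hO).T p := by
  rw [BrandtData.ofOrder_T_ramified_pow_succ hdivp hOp hO (2 * k),
    BrandtData.ofOrder_T_ramified_pow_even hdivp hOp hO k, one_mul]

omit hdivp hOp

/-! ### Eichler packages at `p ∣ N⁻` -/

section Package

variable {Nplus Nminus : ℕ}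

/-- **`B(p^a) = B(p)^a`** for an Eichler package at a prime `p ∣ N⁻`. [cite: VignerasLNM800, Ch. III §5 exercice 5.8 (c)] -/
theorem EichlerPackage.T_pow_of_dvd (P : EichlerPackage Nplus Nminus) {p : ℕ} (hp : p.Prime)
    (hpN : p ∣ Nminus) (a : ℕ) : P.brandtData.T (p ^ a) = P.brandtData.T p ^ a := by
  haveI : Fact p.Prime := ⟨hp⟩
  exact BrandtData.ofOrder_T_ramified_pow (P.forall_isUnit_scalarExtension_padic hpN)
    (P.maximalAtP hpN) P.isEichlerOrder.isZOrder a

/-- **`B(p^{2k}) = 1`** for an Eichler package at `p ∣ N⁻`. [cite: VignerasLNM800, Ch. III §5 exercice 5.8 (c)] -/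
theorem EichlerPackage.T_pow_even_of_dvd (P : EichlerPackage Nplus Nminus) {p : ℕ} (hp : p.Prime)
    (hpN : p ∣ Nminus) (k : ℕ) : P.brandtData.T (p ^ (2 * k)) = 1 := by
  haveI : Fact p.Prime := ⟨hp⟩
  exact BrandtData.ofOrder_T_ramified_pow_even (P.forall_isUnit_scalarExtension_padic hpN)
    (P.maximalAtP hpN) P.isEichlerOrder.isZOrder k

/-- **`B(p^{2k+1}) = B(p)`** for an Eichler package at `p ∣ N⁻`. [cite: VignerasLNM800, Ch. III §5 exercice 5.8 (c)] -/
theorem EichlerPackage.T_pow_odd_of_dvd (P : EichlerPackage Nplus Nminus) {p : ℕ} (hp : p.Prime)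
    (hpN : p ∣ Nminus) (k : ℕ) : P.brandtData.T (p ^ (2 * k + 1)) = P.brandtData.T p := by
  haveI : Fact p.Prime := ⟨hp⟩
  exact BrandtData.ofOrder_T_ramified_pow_odd (P.forall_isUnit_scalarExtension_padic hpN)
    (P.maximalAtP hpN) P.isEichlerOrder.isZOrder k

end Package

end Literature.NumberTheory.Automorphic

end
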